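import Literature.NumberTheory.EllipticCurves.KatoTwistedSelmerFinitenessProofs
import Literature.NumberTheory.EllipticCurves.KatoTwistedFinitenessTrivialCharacterProofs
import Literature.NumberTheory.EllipticCurves.SelmerCorankPrimeDegreeGalois
import Literature.NumberTheory.EllipticCurves.IwasawaLeadingTermProofs
import HarnessLib

/-!
# Kato's Cor. 14.3 (1) over `ℚ(ζ_m)` at the trivial character ⟺ the Selmer clause of bsd.S20

Topic `Literature/NumberTheory/EllipticCurves`; theorems only (no definition, no named fact).

K. Kato, *`p`-adic Hodge theory and values of zeta functions of modular forms*, Astérisque 295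
(2004), Cor. 14.3 (p. 235) of Thm. 14.2 (2) has two parts, both vendored in the tree as named
facts for `A = E` an elliptic curve over `ℚ` and `K = ℚ(ζ_m)`:

* (1) `kato_finite_chiPart_selmer_of_twistedLValue_ne_zero` (`KatoTwistedSelmerFiniteness`):
  `L_{prime(m)}(f, χ, 1) ≠ 0 ⇒ Sel_{p^∞}(E/K)^(χ)` finite, every prime `p` — the `χ`-part for the
  action `σ ↦ σ_*` of `Gal(K/ℚ)` on `H¹(K, E[p^∞])` (`IsLiftOfAut.conjH1Primary` of the chosen
  lifts `liftAut σ`), intersected with `Sel_{p^∞}(E/K)`;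
* (2) `kato_finite_chiPart_of_twistedLValue_ne_zero` (`KatoTwistedFiniteness`): `E(K)^(χ)`
  finite; (1) ⇒ (2) is proved (`KatoTwistedFinitenessKummerDescentProofs`,
  `KatoTwistedSelmerFinitenessProofs`);

and the `K = ℚ`, `χ = 1` case is the older named fact `kato_finite_of_L_one_ne_zero` (`PAdicBSD`,
bsd.S20: `L(E, 1) ≠ 0 ⇒ E(ℚ)`, `Ш(E/ℚ)[p^∞]`, `Sel_{p^∞}(E/ℚ)` finite).
`KatoTwistedFinitenessTrivialCharacterProofs` pins down how part (2) AT THE TRIVIAL CHARACTER and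
the Mordell–Weil clause of bsd.S20 overlap (`E(K)^(1) = ι(E(ℚ))`, Galois descent for points).
This file does the same for part (1) and the SELMER clause of bsd.S20, where descent is no longer
an isomorphism but a map with finite kernel and cokernel:

1. `finite_selmerModelInvariants_of_finite` — for an elliptic curve `E` over a number field `K`,
   a finite Galois extension `F/K` with group `G` and any prime `p`: if `Sel_{p^∞}(E/K)` is finite
   then so is `Sel_{p^∞}(E/F)^G` (in the subgroup model `T^G = selmerModelInvariants` of
   `SelmerCorankPrimeDegreeGalois`). This is the finiteness shadow of Dokchitser–Dokchitser,
   Ann. of Math. 172 (2010), Lemma 4.14 ("`rk_p(E/K) = dim X_p(E/F)^G`"; the tree's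
   `selmerCorank_eq_zpCorank_selmerModelInvariants`), by the same argument: for `ξ ∈ T^G`,
   `res (cor ξ) = [F:K] ξ` and `B · cor ξ ∈ Sel_{p^∞}(E/K)` (`localDegreeBound`), so
   `#Sel_{p^∞}(E/K) · B · [F:K]` kills `T^G`, a `p`-primary group with finite `p`-torsion.
2. `conjH1Primary_resPrimary`, `conjH1_modelIso_eq_of_forall_conjH1Primary_eq`,
   `modelIso_mem_selmerModelInvariants` — for `E/ℚ` and a finite Galois number field `F`:
   restricted classes are `Gal(F/ℚ)`-fixed, and a class of `Sel_{p^∞}(E/F)` fixed by every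
   `σ_*` is, in the subgroup model, fixed by every `g ∈ Γ_ℚ` (`g = c_{σ₀} n` with
   `n ∈ Gal(ℚ̄/F)` acting trivially, `RelModel.modelIso_relConjH1Primary`; the `ℚ`-base action
   `conjH1Primary` of `SelmerPInftyGaloisAction` is definitionally the relative action
   `relConjH1Primary` of `SelmerPInftyRelGaloisAction` at `k = ℚ`, `relConjH1Primary_eq_conjH1Primary`).
3. `finite_chiPart_inf_selmerGroupPInfty_iff_of_forall_eq_one` — hence, for the trivial
   character, **`Sel_{p^∞}(E/F)^(1)` is finite iff `Sel_{p^∞}(E/ℚ)` is finite**: `⇐` by 1–2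
   (`Sel_{p^∞}(E/F)^(1) ↪ T^G` under `modelIso`); `⇒` because restriction
   `Sel_{p^∞}(E/ℚ) → Sel_{p^∞}(E/F)^(1)` has kernel killed by `[F:ℚ]`
   (`index_nsmul_eq_zero_of_resSubgroupH1_eq_zero`), which is finite in a `p`-primary group with
   finite `p`-torsion.
4. Assembly over `K = ℚ(ζ_m)` (`finite_chiPart_one_inf_selmerGroupPInfty_cyclotomic_iff`):
   * `kato_finite_chiPart_selmer_one_of_kato_finite_of_L_one_ne_zero` — **bsd.S20 ⇒ Kato's
     Cor. 14.3 (1) over `ℚ(ζ_m)` at `χ = 1`**, every `m ≥ 1` and every prime `p`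
     (`L_{prime(m)}(f, 𝟙, 1) ≠ 0 ⇒ L(E, 1) ≠ 0`, `entireLFunction_one_ne_zero_of_twistedLSeries_one`
     of the Mordell–Weil-level file, then 3);
   * `finite_selmerGroupPInfty_of_kato_finite_chiPart_selmer` — **conversely the vendored fact
     (1) at `m = 1` gives the Selmer clause of bsd.S20**: `L(E, 1) ≠ 0 ⇒ Sel_{p^∞}(E/ℚ)` finite
     for every `p`, for every elliptic `E/ℚ` with a newform; together with
     `finite_point_of_kato_finite_chiPart` (Mordell–Weil clause, via (1) ⇒ (2)) this is
     `finite_point_and_finite_selmerGroupPInfty_of_kato_finite_chiPart_selmer`;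
   * `finite_primaryComponent_sha_of_finite_selmerGroupPInfty` — `Sel_{p^∞}(E/K)` finite
     `⇒ Ш(E/K)[p^∞]` finite (corank count `corank Sel = rank + corank Ш`,
     `selmerCorank_eq_mordellWeilRank_add_holds`, and `Ш[p^∞]` cofinitely generated,
     `finite_primaryComponent_sha_iff_shaCorank_eq_zero`), whence
     `kato_finite_of_L_one_ne_zero_of_kato_finite_chiPart_selmer` — **bsd.S20 in full
     (`E(ℚ)`, `Ш(E/ℚ)[p^∞]`, `Sel_{p^∞}(E/ℚ)` finite) from the vendored fact (1)** for every
     elliptic `E/ℚ` with a newform, and `…_of_exists_isNewformOf` for every elliptic `E/ℚ`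
     under modularity (`exists_isNewformOf`, Breuil–Conrad–Diamond–Taylor): the named fact
     bsd.S20 is CLOSED MODULO Kato's Cor. 14.3 (1) and modularity.

Nothing here touches Kato's Euler-system argument (Thm. 14.2 (2) proper, §§8–13 and 14.6–14.13 of
the source); the file only makes precise that the apex fact (1) CONTAINS bsd.S20 and, at the
trivial character, is contained in its Selmer clause.

## References

* K. Kato, *`p`-adic Hodge theory and values of zeta functions of modular forms*, Astérisque 295
  (2004), 117–290: 14.1, Thm. 14.2 (2), Cor. 14.3 (1)(2) (p. 235). [Kato2004Asterisque]
* T. Dokchitser, V. Dokchitser, *On the Birch–Swinnerton-Dyer quotients modulo squares*, Ann. of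
  Math. 172 (2010), 567–596: Lemma 4.14 (restriction `Sel_{p^∞}(E/K) → Sel_{p^∞}(E/F)^G` has
  kernel and cokernel killed by `|G|²`). [DokchitserDokchitserAnnals2010]
* R. Greenberg, *Iwasawa theory for elliptic curves*, LNM 1716 (1999), §1 (cofinitely generated
  `p`-primary Selmer groups). [GreenbergLNM1716]
-/

noncomputable section

open scoped Classical AddSubgroup

open WeierstrassCurve CongruenceSubgroup

namespace Literature.NumberTheory.EllipticCurves

open GaloisRepresentations ModularForms

/-! ## 1. `Sel_{p^∞}(E/K)` finite ⇒ `Sel_{p^∞}(E/F)^G` finite (Dokchitser–Dokchitser, Lemma 4.14) -/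

section Invariants

variable {K : Type} [Field K] [NumberField K] (W : WeierstrassCurve K) [W.IsElliptic]
variable (F : Type) [Field F] [NumberField F] [Algebra K F] [IsGalois K F]
variable (p : ℕ) [Fact p.Prime]

/-- **Finiteness shadow of Dokchitser–Dokchitser 2010, Lemma 4.14.** Let `E/K` be an elliptic
curve over a number field, `F/K` finite Galois with group `G`, `p` any prime, and let
`T^G = selmerModelInvariants W F p` be the `Γ_K`-invariants of the model
`T ≅ Sel_{p^∞}(E_F/F)` inside `H¹(Gal(K̄/F), E[p^∞])`. If `Sel_{p^∞}(E/K)` is finite then `T^G` is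
finite. Printed (Lemma 4.14, p. 23): "the restriction map from `H¹(K, E[pⁿ])` to `H¹(F, E[pⁿ])^G`
induces a map `Sel_{pⁿ}(E/K) → Sel_{pⁿ}(E/F)^G` whose kernel and cokernel are killed by `|G|²`,
so the corresponding map `𝔛_p(E/F)^G → 𝔛_p(E/K)` [has] finite kernels and cokernels"; here, as in
the tree's `selmerCorank_eq_zpCorank_selmerModelInvariants`: for `ξ ∈ T^G`, `res (cor ξ) = |G| ξ`
(`resSubgroupH1_coresH1`, the `Γ_K`-invariance of `ξ`) and `B(|G|) · cor ξ ∈ Sel_{p^∞}(E/K)`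
(`localDegreeBound_nsmul_mem_selmerGroupPInfty_of_res_mem`), so `#Sel_{p^∞}(E/K) · B(|G|) · |G|`
kills `T^G`, which is `p`-primary with finite `p`-torsion (`finite_torsionBy_selmerModel`), hence
finite (`finite_of_primary_of_nsmul_eq_zero`).
[cite: DokchitserDokchitserAnnals2010, Lemma 4.14] -/
theorem finite_selmerModelInvariants_of_finite [Finite (selmerGroupPInfty W p)] :
    Finite (selmerModelInvariants W F p) := by
  -- notation and instances (as in the proof of `selmerCorank_eq_zpCorank_selmerModelInvariants`)
  set N : Subgroup (Field.absoluteGaloisGroup K) := galRange (K := K) F with hNdef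
  haveI hNn : N.Normal := RelModel.normal_galRange (K := K) F
  haveI hNf : N.FiniteIndex := RelModel.finiteIndex_galRange (K := K) F
  letI : Fintype (Field.absoluteGaloisGroup K ⧸ N) := Fintype.ofFinite _
  have hNo : IsOpen (N : Set (Field.absoluteGaloisGroup K)) := isOpen_galRange F
  haveI : FiniteDimensional K F := Module.Finite.of_restrictScalars_finite ℚ K F
  set d : ℕ := Module.finrank K F with hddef
  have hidx : N.index = d := RelModel.index_galRange (K := K) F
  have hd : d ≠ 0 := Module.finrank_pos.ne'
  set X := subgroupH1 N (geomPrimaryTorsion W p) with hXdef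
  set T : AddSubgroup X := selmerModel W F p with hTdef
  set TG : AddSubgroup X := selmerModelInvariants W F p with hTGdef
  set S : AddSubgroup (galH1Primary W p) := selmerGroupPInfty W p with hSdef
  -- `T^G ≤ T` is `p`-primary with finite `p`-torsion
  have hTprim : ∀ t : T, ∃ n : ℕ, p ^ n • t = 0 := exists_pow_nsmul_eq_zero_selmerModel W F p
  haveI hTfin : Finite T[(p : ℤ)] := finite_torsionBy_selmerModel W F p
  have hle : TG ≤ T := selmerModelInvariants_le W F p
  obtain ⟨hTGprim, hTGfin⟩ := primary_and_finite_torsionBy_of_injective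
    (i := AddSubgroup.inclusion hle) (AddSubgroup.inclusion_injective hle) hTprim
  haveI := hTGfin
  -- the bounds
  set B : ℕ := localDegreeBound d with hBdef
  have hB : B ≠ 0 := localDegreeBound_ne_zero d
  set c : ℕ := Nat.card S with hcdef
  have hc : c ≠ 0 := Nat.card_pos.ne'
  -- `c * B * d` kills `T^G`
  have hkill : ∀ y : TG, (c * B * d) • y = 0 := by
    intro y
    set ξ : X := (y : X) with hξdef
    have hξT : ξ ∈ T := y.2.1
    have hξall : ∀ g : Field.absoluteGaloisGroup K, conjH1 N (geomPrimaryTorsion W p) g ξ = ξ :=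
      y.2.2
    -- `η = cor ξ` and `res η = d ξ`
    set η : galH1Primary W p := coresH1 N hNo ξ with hηdef
    have hresη : resSubgroupH1 N (geomPrimaryTorsion W p) η = d • ξ := by
      rw [hηdef, resSubgroupH1_coresH1 N hNo (s := Quotient.out) (fun x ↦ QuotientGroup.out_eq' x) ξ]
      calc ∑ x : Field.absoluteGaloisGroup K ⧸ N,
            conjH1 N (geomPrimaryTorsion W p) (Quotient.out x) ξ
          = ∑ _x : Field.absoluteGaloisGroup K ⧸ N, ξ := Finset.sum_congr rfl fun x _ ↦ hξall _
        _ = d • ξ := by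
          rw [Finset.sum_const, Finset.card_univ, ← Nat.card_eq_fintype_card, ← Subgroup.index,
            hidx]
    -- `res η ∈ T`, so `B η ∈ S`, so `c B η = 0`
    have hresηT : resSubgroupH1 N (geomPrimaryTorsion W p) η ∈ T := by
      rw [hresη]; exact T.nsmul_mem hξT d
    have hBη : B • η ∈ S :=
      localDegreeBound_nsmul_mem_selmerGroupPInfty_of_res_mem W F hddef.symm.le p (resPrimary W F p)
        (primaryH1ToH1_resPrimary W F p) (resPrimary_mem_of_resSubgroupH1_mem W F p hresηT)
    have hcBη : (c * B) • η = 0 := by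
      have h1 : c • (⟨B • η, hBη⟩ : S) = 0 := card_nsmul_eq_zero'
      have h2 := congrArg Subtype.val h1
      rw [AddSubmonoidClass.coe_nsmul, ZeroMemClass.coe_zero] at h2
      rw [mul_nsmul']
      exact h2
    -- restrict back to `F`
    have h3 := congrArg (resSubgroupH1 N (geomPrimaryTorsion W p)) hcBη
    rw [map_nsmul, map_zero, hresη, ← mul_nsmul'] at h3
    apply Subtype.ext
    rw [AddSubmonoidClass.coe_nsmul, ZeroMemClass.coe_zero]
    exact h3
  exact finite_of_primary_of_nsmul_eq_zero Fact.out hTGprim (mul_ne_zero (mul_ne_zero hc hB) hd)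
    hkill

end Invariants

/-! ## 2. `E/ℚ`: classes fixed by `Gal(F/ℚ)` versus `Γ_ℚ`-invariants of the model -/

section RationalBase

variable (W : WeierstrassCurve ℚ) (F : Type) [Field F] [NumberField F] (p : ℕ)

/-- For a curve over `ℚ` the relative action `relConjH1Primary` of `SelmerPInftyRelGaloisAction`
(base `k`) at `k = ℚ` is, definitionally, the action `conjH1Primary` of `SelmerPInftyGaloisAction`
(both are the map of the compatible pair `(conjGalCMH, P ↦ τ P)` on `H¹(F, E[p^∞])`). [folklore] -/
theorem relConjH1Primary_eq_conjH1Primary {σ : F ≃ₐ[ℚ] F}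
    {τ : AlgebraicClosure F ≃+* AlgebraicClosure F} (hτ : IsLiftOfAut σ τ) :
    hτ.relConjH1Primary W p = hτ.conjH1Primary W p :=
  rfl

/-- **Restricted classes are `Gal(F/ℚ)`-fixed**: `σ_* (res x) = res x` for `x ∈ H¹(ℚ, E[p^∞])`
and `σ ∈ Gal(F/ℚ)`, `F/ℚ` finite Galois. In the subgroup model `res x` is the plain restriction to
`Gal(ℚ̄/F)` (`modelIso_resPrimary`), `σ_*` is conjugation by the transported lift
(`RelModel.modelIso_relConjH1Primary`), and conjugation fixes restricted classes
(`conjH1_resSubgroupH1`: `(c · f)(h) - f(h) = h f(c) - f(c)` is a coboundary).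
Serre, *Local Fields*, VII.§5. [folklore] -/
theorem conjH1Primary_resPrimary [IsGalois ℚ F] (σ : F ≃ₐ[ℚ] F) (x : galH1Primary W p) :
    (isLiftOfAut_liftAut σ).conjH1Primary W p (resPrimary W F p x) = resPrimary W F p x := by
  haveI := RelModel.normal_galRange (K := ℚ) F
  apply (modelIso F W p).injective
  rw [← relConjH1Primary_eq_conjH1Primary, RelModel.modelIso_relConjH1Primary F W p σ,
    modelIso_resPrimary]
  exact conjH1_resSubgroupH1 _ (continuous_smul_geomPrimaryTorsion W p) _ x

/-- **A class fixed by every `σ_*` is `Γ_ℚ`-invariant in the model.** If `x ∈ H¹(F, E[p^∞])`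
satisfies `σ_* x = x` for all `σ ∈ Gal(F/ℚ)` then `modelIso x ∈ H¹(Gal(ℚ̄/F), E[p^∞])` is fixed by
the conjugation action of every `g ∈ Γ_ℚ`: write `g = c_{σ₀} n` with `n ∈ Gal(ℚ̄/F)`
(`RelModel.exists_liftToAbsGal_inv_mul_mem_galRange`); `n` acts trivially (`conjH1_of_mem`) and
`c_{σ₀}` acts as `σ₀_*` (`RelModel.modelIso_relConjH1Primary`). Serre, *Galois Cohomology*,
I.§2.5; Dokchitser–Dokchitser 2010, Lemma 4.14 (the `G`-action on `Sel_{p^∞}(E/F)`). [folklore] -/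
theorem conjH1_modelIso_eq_of_forall_conjH1Primary_eq [IsGalois ℚ F]
    {x : galH1Primary (W.baseChange F) p}
    (hx : ∀ σ : F ≃ₐ[ℚ] F, (isLiftOfAut_liftAut σ).conjH1Primary W p x = x)
    (g : Field.absoluteGaloisGroup ℚ) :
    haveI := RelModel.normal_galRange (K := ℚ) F
    conjH1 (galRange (K := ℚ) F) (geomPrimaryTorsion W p) g (modelIso F W p x) = modelIso F W p x := by
  haveI := RelModel.normal_galRange (K := ℚ) F
  obtain ⟨σ₀, hn⟩ := RelModel.exists_liftToAbsGal_inv_mul_mem_galRange (K := ℚ) F g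
  have hg : g = liftToAbsGal (K := ℚ) F σ₀ * ((liftToAbsGal (K := ℚ) F σ₀)⁻¹ * g) :=
    (mul_inv_cancel_left _ _).symm
  rw [hg, conjH1_mul_holds _ _, AddMonoidHom.comp_apply, conjH1_of_mem_holds _ _ hn,
    AddMonoidHom.id_apply, ← RelModel.modelIso_relConjH1Primary F W p σ₀ x,
    relConjH1Primary_eq_conjH1Primary, hx σ₀]

/-- **`Sel_{p^∞}(E/F)^{Gal(F/ℚ)} ↪ T^G` under `modelIso`**: a Selmer class over `F` fixed by every
`σ_*` lands in `selmerModelInvariants W F p`. Dokchitser–Dokchitser 2010, Lemma 4.14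
(`Sel_{p^∞}(E/F)^G` viewed inside `H¹(F, E[p^∞])`). [cite: DokchitserDokchitserAnnals2010, Lemma 4.14] -/
theorem modelIso_mem_selmerModelInvariants [IsGalois ℚ F] {x : galH1Primary (W.baseChange F) p}
    (hxS : x ∈ selmerGroupPInfty (W.baseChange F) p)
    (hx : ∀ σ : F ≃ₐ[ℚ] F, (isLiftOfAut_liftAut σ).conjH1Primary W p x = x) :
    modelIso F W p x ∈ selmerModelInvariants W F p :=
  ⟨⟨x, hxS, rfl⟩, fun g ↦ conjH1_modelIso_eq_of_forall_conjH1Primary_eq W F p hx g⟩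

variable [W.IsElliptic] [Fact p.Prime] [IsGalois ℚ F]

/-- **`Sel_{p^∞}(E/F)^(1)` is finite iff `Sel_{p^∞}(E/ℚ)` is finite** (`E/ℚ` elliptic, `F/ℚ` a
finite Galois number field, `p` any prime, `χ = 1` any trivial character into a ring of
characteristic zero, so that Kato's `χ`-part is the group of classes fixed by every `σ_*`,
`mem_chiPart_of_forall_eq_one_iff`).
`⇐`: `Sel_{p^∞}(E/F)^(1) ↪ T^G` (`modelIso_mem_selmerModelInvariants`), finite by
`finite_selmerModelInvariants_of_finite`. `⇒`: restriction `Sel_{p^∞}(E/ℚ) → Sel_{p^∞}(E/F)^(1)`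
(`resPrimary_mem_selmerGroupPInfty`, `conjH1Primary_resPrimary`) has kernel killed by `[F:ℚ]`
(`index_nsmul_eq_zero_of_resSubgroupH1_eq_zero`), finite in the `p`-primary group
`Sel_{p^∞}(E/ℚ)` with finite `p`-torsion (`finite_torsionBy_of_primary`); finite kernel and
finite codomain give a finite domain. This is Kato's Cor. 14.3 (1) at `χ = 1` read against its
`K = ℚ` case (Astérisque 295, p. 235), via Dokchitser–Dokchitser 2010, Lemma 4.14.
[cite: Kato2004Asterisque, Cor. 14.3 (1) (p. 235)] -/
theorem finite_chiPart_inf_selmerGroupPInfty_iff_of_forall_eq_one {R : Type*} [CommRing R]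
    [CharZero R] {χ : (F ≃ₐ[ℚ] F) → R} (hχ : ∀ σ, χ σ = 1) :
    Finite ↥(chiPart (fun σ : F ≃ₐ[ℚ] F => (isLiftOfAut_liftAut σ).conjH1Primary W p) χ ⊓
        selmerGroupPInfty (W.baseChange F) p) ↔
      Finite (selmerGroupPInfty W p) := by
  set C : AddSubgroup (galH1Primary (W.baseChange F) p) :=
    chiPart (fun σ : F ≃ₐ[ℚ] F => (isLiftOfAut_liftAut σ).conjH1Primary W p) χ ⊓
      selmerGroupPInfty (W.baseChange F) p with hCdef
  have hρ : ∀ x : galH1Primary (W.baseChange F) p,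
      (isLiftOfAut_liftAut (1 : F ≃ₐ[ℚ] F)).conjH1Primary W p x = x := fun x ↦ by
    rw [conjH1Primary_liftAut_one]; rfl
  have hmemC : ∀ {x : galH1Primary (W.baseChange F) p}, x ∈ C ↔
      (∀ σ : F ≃ₐ[ℚ] F, (isLiftOfAut_liftAut σ).conjH1Primary W p x = x) ∧
        x ∈ selmerGroupPInfty (W.baseChange F) p := fun {x} ↦ by
    rw [hCdef, AddSubgroup.mem_inf, mem_chiPart_of_forall_eq_one_iff hρ hχ]
  -- `Sel_{p^∞}(E/ℚ)` is `p`-primary with finite `p`-torsion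
  have hSprim : ∀ s : selmerGroupPInfty W p, ∃ n : ℕ, p ^ n • s = 0 := fun s ↦ by
    obtain ⟨n, hn⟩ := exists_pow_nsmul_eq_zero_galH1Primary W p (s : galH1Primary W p)
    exact ⟨n, Subtype.ext (by rw [AddSubmonoidClass.coe_nsmul]; exact hn)⟩
  haveI hSfin : Finite (selmerGroupPInfty W p)[(p : ℤ)] := finite_torsionBy_selmerGroupPInfty W p
  constructor
  · -- `⇒`: restriction has finite kernel
    intro hC
    haveI : Finite C := hC
    set N : Subgroup (Field.absoluteGaloisGroup ℚ) := galRange (K := ℚ) F with hNdef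
    haveI hNf : N.FiniteIndex := RelModel.finiteIndex_galRange (K := ℚ) F
    letI : Fintype (Field.absoluteGaloisGroup ℚ ⧸ N) := Fintype.ofFinite _
    have hNo : IsOpen (N : Set (Field.absoluteGaloisGroup ℚ)) := isOpen_galRange F
    set d : ℕ := Module.finrank ℚ F with hddef
    have hidx : N.index = d := RelModel.index_galRange (K := ℚ) F
    have hd : d ≠ 0 := Module.finrank_pos.ne'
    let f : selmerGroupPInfty W p →+ C :=
      ((resPrimary W F p).comp (selmerGroupPInfty W p).subtype).codRestrict C fun s ↦
        hmemC.mpr ⟨fun σ ↦ conjH1Primary_resPrimary W F p σ _,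
          resPrimary_mem_selmerGroupPInfty W F p s.2⟩
    have hfcoe : ∀ s : selmerGroupPInfty W p, ((f s : C) : galH1Primary (W.baseChange F) p) =
        resPrimary W F p (s : galH1Primary W p) := fun _ ↦ rfl
    -- the kernel is killed by `d`
    have hker : ∀ s : selmerGroupPInfty W p, f s = 0 → d • (s : galH1Primary W p) = 0 := by
      intro s hs
      have h0 : resPrimary W F p (s : galH1Primary W p) = 0 := by
        rw [← hfcoe, hs]; rfl
      have h1 : resSubgroupH1 N (geomPrimaryTorsion W p) (s : galH1Primary W p) = 0 := by
        have e := modelIso_resPrimary F W p (s : galH1Primary W p)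
        rw [h0, map_zero] at e
        exact e.symm
      rw [← hidx]
      exact index_nsmul_eq_zero_of_resSubgroupH1_eq_zero N hNo h1
    haveI : Finite (selmerGroupPInfty W p)[(d : ℤ)] :=
      finite_torsionBy_of_primary _ Fact.out hSprim hd
    haveI : Finite f.ker := by
      refine Finite.of_injective
        (fun s : f.ker ↦ (⟨(s : selmerGroupPInfty W p), ?_⟩ : (selmerGroupPInfty W p)[(d : ℤ)]))
        ?_
      · refine AddSubgroup.torsionBy.nsmul_iff.mpr (Subtype.ext ?_)
        rw [AddSubmonoidClass.coe_nsmul, ZeroMemClass.coe_zero]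
        exact hker _ ((AddMonoidHom.mem_ker).mp s.2)
      · intro s t hst
        exact Subtype.ext
          (congrArg (fun z : (selmerGroupPInfty W p)[(d : ℤ)] ↦ (z : selmerGroupPInfty W p)) hst)
    letI : Fintype f.ker := Fintype.ofFinite _
    letI : Fintype C := Fintype.ofFinite _
    letI : Fintype (selmerGroupPInfty W p) := AddGroup.fintypeOfKerOfCodom f
    infer_instance
  · -- `⇐`: `C ↪ T^G`
    intro hS
    haveI := hS
    haveI : Finite (selmerModelInvariants W F p) := finite_selmerModelInvariants_of_finite W F p
    refine Finite.of_injective (fun x : C ↦ (⟨modelIso F W p x,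
      modelIso_mem_selmerModelInvariants W F p (hmemC.mp x.2).2 (hmemC.mp x.2).1⟩ :
        selmerModelInvariants W F p)) ?_
    intro x y hxy
    exact Subtype.ext ((modelIso F W p).injective (congrArg Subtype.val hxy))

end RationalBase

/-! ## 3. Assembly over `K = ℚ(ζ_m)` -/

section Assembly

variable {m : ℕ} [NeZero m]

set_option backward.isDefEq.respectTransparency false in
/-- **Kato's Cor. 14.3 (1) over `ℚ(ζ_m)` at the trivial character ⟺ `Sel_{p^∞}(E/ℚ)` finite.**
For `E = W/ℚ` elliptic, `m ≥ 1`, `K = ℚ(ζ_m)` and any prime `p`: the `χ`-part of `Sel_{p^∞}(E/K)`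
at the trivial Dirichlet character mod `m` (the conclusion of
`kato_finite_chiPart_selmer_of_twistedLValue_ne_zero` at `χ = 1`, any `m`) is finite iff
`Sel_{p^∞}(E/ℚ)` is (`finite_chiPart_inf_selmerGroupPInfty_iff_of_forall_eq_one`, `ℚ(ζ_m)/ℚ`
being Galois and `cyclotomicCharacterOf 𝟙 = 1`). (The option
`backward.isDefEq.respectTransparency false` identifies the two `ℚ`-algebra structures on
`CyclotomicField m ℚ`, as in `KatoTwistedSelmerFiniteness`.)
[cite: Kato2004Asterisque, Cor. 14.3 (1) (p. 235)] -/
theorem finite_chiPart_one_inf_selmerGroupPInfty_cyclotomic_iff (W : WeierstrassCurve ℚ)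
    [W.IsElliptic] (p : ℕ) [Fact p.Prime] :
    Finite ↥(chiPart (fun σ : CyclotomicField m ℚ ≃ₐ[ℚ] CyclotomicField m ℚ =>
          (isLiftOfAut_liftAut σ).conjH1Primary W p)
        (fun σ => (cyclotomicCharacterOf (1 : DirichletCharacter ℂ m) σ : ℂ)) ⊓
      selmerGroupPInfty (W.baseChange (CyclotomicField m ℚ)) p) ↔
      Finite (selmerGroupPInfty W p) := by
  haveI := IsCyclotomicExtension.isGalois {m} ℚ (CyclotomicField m ℚ)
  exact finite_chiPart_inf_selmerGroupPInfty_iff_of_forall_eq_one W (CyclotomicField m ℚ) p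
    cyclotomicCharacterOf_one_apply

set_option backward.isDefEq.respectTransparency false in
/-- **bsd.S20 ⇒ Kato's Cor. 14.3 (1) over `ℚ(ζ_m)` at the trivial character, every `m ≥ 1` and
every prime `p`.** Assume `kato_finite_of_L_one_ne_zero W p` for every elliptic `W/ℚ` and prime
`p` (Kato, Astérisque 295, Cor. 14.3 for `K = ℚ`, `χ = 1`: `L(E, 1) ≠ 0 ⇒ … Sel_{p^∞}(E/ℚ)`
finite). Then for `E = W/ℚ` elliptic with newform `f`, `K = ℚ(ζ_m)` and the trivial character
`𝟙` mod `m`: if an entire continuation of `L_{prime(m)}(f, 𝟙, s)` does not vanish at `s = 1`,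
the `χ`-part `Sel_{p^∞}(E/K)^(𝟙)` is finite — the instance `χ = 1` of the statement of
`kato_finite_chiPart_selmer_of_twistedLValue_ne_zero` (there `m ≢ 2 (mod 4)`; here any `m`).
Proof: `L_{prime(m)}(f, 𝟙, 1) ≠ 0 ⇒ L(E, 1) ≠ 0`
(`entireLFunction_one_ne_zero_of_twistedLSeries_one`) `⇒ Sel_{p^∞}(E/ℚ)` finite (bsd.S20 at `p`)
`⇒ Sel_{p^∞}(E/K)^(𝟙)` finite (`finite_chiPart_one_inf_selmerGroupPInfty_cyclotomic_iff`).
[cite: Kato2004Asterisque, Cor. 14.3 (1) (p. 235)] -/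
theorem kato_finite_chiPart_selmer_one_of_kato_finite_of_L_one_ne_zero
    (hK : ∀ (W : WeierstrassCurve ℚ) [W.IsElliptic] (p : ℕ) [Fact p.Prime],
      kato_finite_of_L_one_ne_zero W p)
    (W : WeierstrassCurve ℚ) [W.IsElliptic] {N : ℕ} [NeZero N] {f : CuspForm (Gamma0 N) 2}
    (hf : IsNewformOf W f)
    (hL : ∃ L : ℂ → ℂ, Differentiable ℂ L ∧
      (∀ s : ℂ, 2 < s.re → L s = twistedLSeries f (1 : DirichletCharacter ℂ m) s) ∧ L 1 ≠ 0)
    (p : ℕ) [Fact p.Prime] :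
    Finite ↥(chiPart (fun σ : CyclotomicField m ℚ ≃ₐ[ℚ] CyclotomicField m ℚ =>
          (isLiftOfAut_liftAut σ).conjH1Primary W p)
        (fun σ => (cyclotomicCharacterOf (1 : DirichletCharacter ℂ m) σ : ℂ)) ⊓
      selmerGroupPInfty (W.baseChange (CyclotomicField m ℚ)) p) := by
  haveI : Finite (selmerGroupPInfty W p) :=
    (hK W p (entireLFunction_one_ne_zero_of_twistedLSeries_one hf hL)).2.2
  exact (finite_chiPart_one_inf_selmerGroupPInfty_cyclotomic_iff W p).mpr ‹_›

set_option backward.isDefEq.respectTransparency false in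
/-- **Kato's Cor. 14.3 (1) over `ℚ(ζ_1)` gives the Selmer clause of bsd.S20.** Assume the vendored
fact `kato_finite_chiPart_selmer_of_twistedLValue_ne_zero` (Kato, Astérisque 295, Cor. 14.3 (1),
`K = ℚ(ζ_m)`, `m ≢ 2 (mod 4)`, every `p`). Then for every elliptic `E = W/ℚ` with a newform `f`
and every prime `p`: `L(E, 1) ≠ 0 ⇒ Sel_{p^∞}(E/ℚ)` is finite (the third clause of
`kato_finite_of_L_one_ne_zero W p`; Kato, Cor. 14.3 (1) with `K = ℚ`, `χ = 1`). Proof: take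
`m = 1`, `χ = 𝟙`, the continuation `L = L(E, ·)`
(`exists_continuation_twistedLSeries_one_of_entireLFunction_one_ne_zero`), and descend
(`finite_chiPart_one_inf_selmerGroupPInfty_cyclotomic_iff`).
[cite: Kato2004Asterisque, Cor. 14.3 (1) (p. 235)] -/
theorem finite_selmerGroupPInfty_of_kato_finite_chiPart_selmer
    (h : kato_finite_chiPart_selmer_of_twistedLValue_ne_zero)
    (W : WeierstrassCurve ℚ) [W.IsElliptic] {N : ℕ} [NeZero N] {f : CuspForm (Gamma0 N) 2}
    (hf : IsNewformOf W f) (h1 : W.entireLFunction 1 ≠ 0) (p : ℕ) [Fact p.Prime] :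
    Finite (selmerGroupPInfty W p) := by
  have hfin := h W hf (m := 1) (by decide) 1
    (exists_continuation_twistedLSeries_one_of_entireLFunction_one_ne_zero hf h1) p
  exact (finite_chiPart_one_inf_selmerGroupPInfty_cyclotomic_iff W p).mp hfin

/-- **Kato's Cor. 14.3 (1) gives the Mordell–Weil and Selmer clauses of bsd.S20** for every
elliptic `E/ℚ` with a newform: `L(E, 1) ≠ 0 ⇒ E(ℚ)` finite and `Sel_{p^∞}(E/ℚ)` finite for every
prime `p` — the Mordell–Weil clause through (1) ⇒ (2)
(`kato_finite_chiPart_of_twistedLValue_ne_zero_of_kato_finite_chiPart_selmer`, then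
`finite_point_of_kato_finite_chiPart`), the Selmer clause by
`finite_selmerGroupPInfty_of_kato_finite_chiPart_selmer`. (The remaining clause of bsd.S20,
finiteness of `Ш(E/ℚ)[p^∞]`, a quotient of `Sel_{p^∞}(E/ℚ)`, is not rederived here.)
[cite: Kato2004Asterisque, Cor. 14.3 (1)(2) (p. 235)] -/
theorem finite_point_and_finite_selmerGroupPInfty_of_kato_finite_chiPart_selmer
    (h : kato_finite_chiPart_selmer_of_twistedLValue_ne_zero)
    (W : WeierstrassCurve ℚ) [W.IsElliptic] {N : ℕ} [NeZero N] {f : CuspForm (Gamma0 N) 2}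
    (hf : IsNewformOf W f) (h1 : W.entireLFunction 1 ≠ 0) (p : ℕ) [Fact p.Prime] :
    Finite W.toAffine.Point ∧ Finite (selmerGroupPInfty W p) :=
  ⟨finite_point_of_kato_finite_chiPart
      (kato_finite_chiPart_of_twistedLValue_ne_zero_of_kato_finite_chiPart_selmer h) W hf h1,
    finite_selmerGroupPInfty_of_kato_finite_chiPart_selmer h W hf h1 p⟩

/-- **`Sel_{p^∞}(E/K)` finite ⇒ `Ш(E/K)[p^∞]` finite** (elliptic curve over a number field, any
prime `p`): `corank_{ℤ_p} Sel_{p^∞} = rank E(K) + corank_{ℤ_p} Ш[p^∞]`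
(`selmerCorank_eq_mordellWeilRank_add_holds`, Greenberg 1999 §1), a finite group has corank `0`
(`zpCorank_eq_zero_of_finite`), and the cofinitely generated `p`-primary group `Ш[p^∞]` is finite
iff its corank vanishes (`finite_primaryComponent_sha_iff_shaCorank_eq_zero`). (Directly:
`Ш[p^∞]` is a quotient of `Sel_{p^∞}` by the Kummer sequence; the corank count is the form the
tree already has.) [cite: GreenbergLNM1716, §1] -/
theorem finite_primaryComponent_sha_of_finite_selmerGroupPInfty {K : Type} [Field K]
    [NumberField K] (W : WeierstrassCurve K) [W.IsElliptic] (p : ℕ) [Fact p.Prime]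
    [Finite (selmerGroupPInfty W p)] : Finite (AddCommGroup.primaryComponent W.sha p) := by
  refine (finite_primaryComponent_sha_iff_shaCorank_eq_zero W p).2 ?_
  have h := W.selmerCorank_eq_mordellWeilRank_add_holds p
  have h0 : W.selmerCorank p = 0 := zpCorank_eq_zero_of_finite _ p
  omega

/-- **bsd.S20 from Kato's Cor. 14.3 (1)**, for every elliptic `E = W/ℚ` with a newform `f` and
every prime `p`: the vendored fact `kato_finite_chiPart_selmer_of_twistedLValue_ne_zero` (Kato,
Astérisque 295, Cor. 14.3 (1) over `ℚ(ζ_m)`, every `p`) implies `kato_finite_of_L_one_ne_zero W p`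
(`L(E, 1) ≠ 0 ⇒ E(ℚ)`, `Ш(E/ℚ)[p^∞]`, `Sel_{p^∞}(E/ℚ)` finite; Kato, Cor. 14.3 with `K = ℚ`,
`χ = 1`): Mordell–Weil and Selmer clauses by
`finite_point_and_finite_selmerGroupPInfty_of_kato_finite_chiPart_selmer` (take `m = 1`), the
`Ш[p^∞]` clause by `finite_primaryComponent_sha_of_finite_selmerGroupPInfty`.
[cite: Kato2004Asterisque, Cor. 14.3 (1)(2) (p. 235)] -/
theorem kato_finite_of_L_one_ne_zero_of_kato_finite_chiPart_selmer
    (h : kato_finite_chiPart_selmer_of_twistedLValue_ne_zero)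
    (W : WeierstrassCurve ℚ) [W.IsElliptic] {N : ℕ} [NeZero N] {f : CuspForm (Gamma0 N) 2}
    (hf : IsNewformOf W f) (p : ℕ) [Fact p.Prime] : kato_finite_of_L_one_ne_zero W p := by
  intro h1
  obtain ⟨hpt, hsel⟩ :=
    finite_point_and_finite_selmerGroupPInfty_of_kato_finite_chiPart_selmer h W hf h1 p
  haveI := hsel
  exact ⟨hpt, finite_primaryComponent_sha_of_finite_selmerGroupPInfty W p, hsel⟩

/-- **bsd.S20 is closed modulo Kato's Cor. 14.3 (1) and modularity**: assuming the vendored fact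
`kato_finite_chiPart_selmer_of_twistedLValue_ne_zero` and the modularity theorem in the form
`exists_isNewformOf` (every elliptic `E/ℚ` has a newform of level `N_E`; Breuil–Conrad–Diamond–
Taylor 2001, Thm. A, with Carayol's level), `kato_finite_of_L_one_ne_zero W p` holds for EVERY
elliptic `W/ℚ` and every prime `p` (`NeZero N_E` from `conductorNorm_pos_holds`). This is the
`K = ℚ`, `χ = 1` case of Kato's corollary as the tree states it (bsd.S20), whose hypothesis
"`A` a quotient of `J₁(N)`" is exactly what modularity supplies for `A = E`.
[cite: Kato2004Asterisque, Cor. 14.3 (1)(2) (p. 235)] -/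
theorem kato_finite_of_L_one_ne_zero_of_kato_finite_chiPart_selmer_of_exists_isNewformOf
    (hmod : exists_isNewformOf) (h : kato_finite_chiPart_selmer_of_twistedLValue_ne_zero)
    (W : WeierstrassCurve ℚ) [W.IsElliptic] (p : ℕ) [Fact p.Prime] :
    kato_finite_of_L_one_ne_zero W p := by
  haveI : NeZero (W.conductorNorm ℤ) := ⟨(W.conductorNorm_pos_holds).ne'⟩
  obtain ⟨f, hf⟩ := hmod W
  exact kato_finite_of_L_one_ne_zero_of_kato_finite_chiPart_selmer h W hf p

end Assembly

end Literature.NumberTheory.EllipticCurves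

end
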